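import Literature.Algebra.EuclideanLattices.RegevRoutineCoins
import Literature.Computability.QuantumComplexity.DCPMixture
import HarnessLib

/-!
# Regev's per-copy routine as a circuit family, VII: the registers handed to the solver

Seventh file of the circuit-level construction towards the discharge of
`Literature.Algebra.EuclideanLattices.usvp_of_dihedralCoset` (O. Regev, *Quantum computation and
lattice problems*, SIAM J. Comput. 33 (2004), Thm. 1.1). This file proves the **success bound of
the routine** (the probability analysis of the proof of Lemma 3.12, p. 14, in the tree's
measurement-free model): if, for every *good* guess pattern (a decidable set `Good` of contents
of the guess zone: those showing the right guesses on the wires the blocks read), the block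
function `fW` has register-shaped fibres on every live coin zone (a fibre is a single pattern — a
bad register — or two patterns with control bits `0`, `1` and slot values `x`, `(x + d₀) mod N` —
a good one) and is injective on the dead zones (`FibreHyp`, the abstract form of Claims 3.13–3.14),
then the probability that the routine's output shows a good guess pattern on the guess zone and
the hidden shift `d₀` on the solver's answer wires is at least `(#good / 2^{|guess zone|}) · q`,
where `q` is the solver's success probability on admissible inputs — provided each live register
is good for all but a fraction `1/(log₂ N)^f` of the patterns of its zone:

* `encodeNat_two_pow`, `len_modN`, `bitVal`, `testBit_bitVal`, `bitVal_inj` — numerals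
  (`N = modN n = 2^{ℓ−1}`, so that `len N = ℓ` and `encodeNat N = 0^{ℓ−1} 1`) and slot values;
* `tacP`, `ctrl`, `val`, `zW` — the `ta` coins, control bit, slot value and `W`-word of a zone
  pattern; **`FibreHyp`** — the fibre hypotheses;
* `fsOf`, `kappa_branchOf_apply`, `act_iff_of_good`, `wordW_eq_zW`, `fsOf_gz`/`fsOf_gt`/
  `fsOf_slot`/`fsOf_g`, `toWires_fsOf_eq_false` — the final state of the branch with given coins,
  through file V's `finSt`;
* `Toff`, `gOf`, `toff_iff` — the off-block event "the guess zone shows a good pattern";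
  **`sameOff_of_extend_eq`**, **`extend_eq_of_sameOff`** — two branches have the same content off
  the solver's block iff they have the same guess pattern, their live zones the same `fW`-values
  and their dead zones the same patterns (`SameOff`); `dcpSet_of_sameOff`, `exists_of_dcpSet`,
  `rhoOf_eq_of_sameOff` — the block contents of such a fibre are exactly the support
  `DCPMixture.DcpSet` of the DCP input state with contents `rhoOf c`;
* `card_filter_prod_eq_sum`, `card_filter_apply_eq` — product counting;
* `goodOutputs`, `mem_goodOutputs_iff`, **`kernelProb_goodOutputs_ge`** — the bound, via
  `DCPMixture.bornSum_ge`.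

No named fact is introduced.

## References

* O. Regev, *Quantum computation and lattice problems*, SIAM J. Comput. 33 (2004) 738–760, proof
  of Lemma 3.12 (p. 14) and Claims 3.13, 3.14 (p. 15) [Regev2004].
* M. A. Nielsen, I. L. Chuang, *Quantum Computation and Quantum Information*, CUP 2010, §4.4
  (principle of deferred measurement) [NielsenChuang2010].
-/

noncomputable section

namespace Literature.Algebra.EuclideanLattices

namespace RegevRoutine

open _root_.Computability Literature.Computability.Complexity Literature.Computability.Cryptography
  Literature.Computability.Cryptography.DCP Literature.Computability.QuantumComplexity
  Literature.Computability.QuantumComplexity.DCPMixture Literature.Computability.QuantumComplexity.ZoneGadgets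
  Turing RevSim RevClean RevMux Matrix Finset

variable {P : Params}

/-! ### Numerals -/

/-- `encodeNat 2^j = 0^j 1` (a twin of `TavRecode.encodeNat_two_pow` and of the copies in
`StackWordArith.lean`/`SISFunctionProofs.lean`, none of which is in the import closure here). [folklore] -/
theorem encodeNat_two_pow (j : ℕ) : encodeNat (2 ^ j) = List.replicate j false ++ [true] := by
  refine eq_of_bitsToNat_eq_of_canonical _ _ (encodeNat_canonical _) (Or.inr ⟨_, rfl⟩) ?_
  rw [bitsToNat_encodeNat, bitsToNat_append]; simp

/-- `len 2^j = j + 1`. [folklore] -/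
theorem len_two_pow (j : ℕ) : DCP.len (2 ^ j) = j + 1 := by
  unfold DCP.len; rw [encodeNat_two_pow]; simp

/-- The letters of `encodeNat 2^j`. [folklore] -/
theorem getD_encodeNat_two_pow (j t : ℕ) : (encodeNat (2 ^ j)).getD t false = decide (t = j) := by
  rw [encodeNat_two_pow]
  rcases lt_trichotomy t j with h | rfl | h
  · rw [List.getD_append _ _ _ _ (by simpa using h)]; simp [h, h.ne]
  · rw [List.getD_append_right _ _ _ _ (by simp)]; simp
  · rw [List.getD_eq_default _ _ (by simp; omega)]; simp [h.ne']

/-- **The modulus of the instance at dimension `n`**: `N = 2^{ℓ−1} = (2M)ⁿ`. [cite: Regev2004, Lemma 3.2 (N = (2M)^n)] -/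
def modN (n : ℕ) : ℕ := 2 ^ (ell n - 1)

/-- `1 ≤ ell n` (for the routine's `ell`; unrelated to the homonym of the sieve files). [folklore] -/
theorem one_le_ell (n : ℕ) : 1 ≤ ell n := by unfold ell; omega

/-- `len N = ℓ`. [folklore] -/
theorem len_modN (n : ℕ) : DCP.len (modN n) = ell n := by
  unfold modN; rw [len_two_pow]; have := one_le_ell n; omega

/-- The letters of `encodeNat N`. [folklore] -/
theorem getD_encodeNat_modN (n t : ℕ) : (encodeNat (modN n)).getD t false = decide (t = ell n - 1) :=
  getD_encodeNat_two_pow _ _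

/-- `2 ≤ N` (for `n ≥ 1`). [folklore] -/
theorem two_le_modN {n : ℕ} (hn : 1 ≤ n) : 2 ≤ modN n := by
  unfold modN ell
  have : 1 ≤ n * (4 * n + 1) := Nat.one_le_iff_ne_zero.2 (Nat.mul_ne_zero (by omega) (by omega))
  calc 2 = 2 ^ 1 := rfl
    _ ≤ 2 ^ (n * (4 * n + 1) + 1 - 1) := Nat.pow_le_pow_right (by norm_num) (by omega)

/-! ### Bit sums -/

/-- The number with binary digits `b 0, …, b (ℓ−1)` (little-endian). [folklore] -/
def bitVal (b : ℕ → Bool) (ℓ : ℕ) : ℕ := ∑ t ∈ range ℓ, if b t then 2 ^ t else 0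

/-- `bitVal` with one more digit. [folklore] -/
theorem bitVal_succ (b : ℕ → Bool) (ℓ : ℕ) : bitVal b (ℓ + 1) = bitVal b ℓ + if b ℓ then 2 ^ ℓ else 0 := by
  unfold bitVal; rw [sum_range_succ]

/-- `bitVal b ℓ < 2^ℓ`. [folklore] -/
theorem bitVal_lt (b : ℕ → Bool) : ∀ ℓ, bitVal b ℓ < 2 ^ ℓ
  | 0 => by simp [bitVal]
  | ℓ + 1 => by rw [bitVal_succ, pow_succ]; have := bitVal_lt b ℓ; split_ifs <;> omega

/-- **The binary digits of `bitVal`.** [folklore] -/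
theorem testBit_bitVal (b : ℕ → Bool) : ∀ ℓ t, (bitVal b ℓ).testBit t = (decide (t < ℓ) && b t)
  | 0, t => by simp [bitVal]
  | ℓ + 1, t => by
    rw [bitVal_succ]
    have hlt := bitVal_lt b ℓ
    by_cases hb : b ℓ
    · rw [if_pos hb, add_comm]
      rcases lt_trichotomy t ℓ with h | rfl | h
      · rw [Nat.testBit_two_pow_add_gt h, testBit_bitVal b ℓ t]; simp [h, Nat.lt_succ_of_lt h]
      · rw [Nat.testBit_two_pow_add_eq, testBit_bitVal b t t]; simp [hb]
      · rw [Nat.testBit_eq_false_of_lt]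
        · simp; omega
        · calc 2 ^ ℓ + bitVal b ℓ < 2 ^ ℓ + 2 ^ ℓ := by omega
            _ = 2 ^ (ℓ + 1) := by rw [pow_succ]; ring
            _ ≤ 2 ^ t := Nat.pow_le_pow_right (by norm_num) h
    · rw [if_neg hb, add_zero, testBit_bitVal b ℓ t]
      rcases lt_trichotomy t ℓ with h | rfl | h
      · simp [h, Nat.lt_succ_of_lt h]
      · simp [hb]
      · simp [not_lt.2 h.le, show ¬ t < ℓ + 1 by omega]

/-- **`bitVal` is injective in the digits below `ℓ`.** [folklore] -/
theorem bitVal_inj {b b' : ℕ → Bool} {ℓ : ℕ} (h : bitVal b ℓ = bitVal b' ℓ) {t : ℕ} (ht : t < ℓ) : b t = b' t := by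
  have := congrArg (fun m => m.testBit t) h
  simp only [testBit_bitVal, ht, decide_true, Bool.true_and] at this
  exact this

/-- `readNat` is a `bitVal`. [folklore] -/
theorem readNat_eq_bitVal {m : ℕ} (s : QReg m) (p ℓ : ℕ) : readNat s p ℓ = bitVal (fun t => qbit s (p + t)) ℓ := rfl

/-! ### The data of a zone pattern -/

section ZoneData

variable (P) (L n : ℕ)

/-- The `ta` coins of a zone pattern: control bit, then the `ℓ` data bits of the slot. [folklore] -/
def tacP (p : ZPat P L n) : ℕ → Bool := fun t => zoneFn P L n p (kap P L + t)

/-- The control bit `t` of a zone pattern. [cite: Regev2004, Lemma 3.12 (proof, p. 14: the first register t ∈ {0,1})] -/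
def ctrl (p : ZPat P L n) : Bool := tacP P L n p 0

/-- The slot value of a zone pattern: the number written on the `ℓ` data bits (the base-`2M`
number of `ā`). [cite: Regev2004, Lemma 3.2 (the map (a₁,…,aₙ) ↦ a₁ + a₂ 2M + ⋯)] -/
def val (p : ZPat P L n) : ℕ := bitVal (fun t => tacP P L n p (1 + t)) (ell n)

/-- The word the block `W` receives for register `k` when zone `k` has pattern `p`, the input is `x`
and the guesses are `g₀`. [cite: Regev2004, Lemma 3.12 (proof, p. 14)] -/
def zW (x : List Bool) (g₀ : GPat P L) (k : ℕ) (p : ZPat P L n) : List Bool :=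
  wordW P L x (gExt P L g₀) (zoneFn P L n p) (tacP P L n p) k

variable {P L n}

/-- The `ta` coins vanish from `sig` on (indeed from `slotW n` on). [folklore] -/
theorem tacP_eq_false_of_le (p : ZPat P L n) {t : ℕ} (ht : slotW n ≤ t) : tacP P L n p t = false :=
  zoneFn_eq_false p fun h => by have := h.lt; omega

/-- The length of `wordW`. [folklore] -/
theorem length_wordW (x : List Bool) (g ixc tac : ℕ → Bool) (k : ℕ) : (wordW P L x g ixc tac k).length = n0W P L := by
  simp [wordW, unaryU, counterWord, n0W]; ring

end ZoneData

/-! ### The fibre hypotheses -/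

/-- **The fibre hypotheses** for the input `x`, the right guesses — a decidable set `Good` of guess
patterns (those agreeing with the right values on the wires the blocks read) —, the true register
count `r` and the hidden shift `d₀` (the abstract content of Regev's Claims 3.13–3.14 and of the
layout of Lemma 3.2): for every good guess pattern, live registers are exactly `k < r` (and
liveness only reads the guess zone); their slots lie in the solver's block; on a live zone the
block function's fibres are register shaped — every pattern `p'` with the same `fW`-value as `p`
has control bit and slot value in the register relation of `regOf g k p`, is determined by them,
and every element of the relation is attained —; on a dead zone the `fW`-value and the `ta` coins
determine the pattern.
[cite: Regev2004, Lemma 3.12 (proof, p. 14: "the state collapses to … (|0,ā⟩+|1,ā'⟩)/√2 … if ā' ∉ A the register is bad")] -/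
structure FibreHyp (P : Params) (S : SemHyp P) (x : List Bool) (Good : GPat P x.length → Prop) (r d₀ : ℕ) where
  /-- `r ≤ rmax` -/
  hr : r ≤ rmax P x.length
  /-- the live slots fit into the solver's block -/
  fits : ell (nOf x.length) + r * slotW (nOf x.length) ≤ ell (nOf x.length) + P.FD.ancillas (ell (nOf x.length))
  /-- for a good guess pattern, liveness is `k < r` -/
  act_iff : ∀ g, Good g → ∀ k, k < rmax P x.length → (S.Act x.length x (gExt P x.length g) k ↔ k < r)
  /-- liveness only reads the guess zone -/
  act_congr : ∀ (g : GPat P x.length) (g' : ℕ → Bool) (k : ℕ), (∀ t, t < gam P x.length → g' t = gExt P x.length g t) →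
    (S.Act x.length x g' k ↔ S.Act x.length x (gExt P x.length g) k)
  /-- the register content of a live zone with a given pattern, under a given guess pattern -/
  regOf : GPat P x.length → Fin r → ZPat P x.length (nOf x.length) → Register (modN (nOf x.length))
  /-- fibres of live zones lie in the register relation, on which `regOf` is constant -/
  rel : ∀ g, Good g → ∀ (k : Fin r) (p p' : ZPat P x.length (nOf x.length)),
    P.fW (zW P x.length (nOf x.length) x g k p') = P.fW (zW P x.length (nOf x.length) x g k p) →
      RegRel (modN (nOf x.length)) d₀ (regOf g k p) (ctrl P x.length (nOf x.length) p') (val P x.length (nOf x.length) p') ∧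
        regOf g k p' = regOf g k p
  /-- within a fibre of a live zone, control bit and slot value determine the pattern -/
  inj : ∀ g, Good g → ∀ (k : Fin r) (p p' : ZPat P x.length (nOf x.length)),
    P.fW (zW P x.length (nOf x.length) x g k p') = P.fW (zW P x.length (nOf x.length) x g k p) →
      ctrl P x.length (nOf x.length) p' = ctrl P x.length (nOf x.length) p →
        val P x.length (nOf x.length) p' = val P x.length (nOf x.length) p → p' = p
  /-- every element of the register relation is attained in the fibre -/
  surj : ∀ g, Good g → ∀ (k : Fin r) (p : ZPat P x.length (nOf x.length)) (cb : Bool) (v : ℕ),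
    RegRel (modN (nOf x.length)) d₀ (regOf g k p) cb v →
      ∃ p', P.fW (zW P x.length (nOf x.length) x g k p') = P.fW (zW P x.length (nOf x.length) x g k p) ∧
        ctrl P x.length (nOf x.length) p' = cb ∧ val P x.length (nOf x.length) p' = v
  /-- on a dead zone, the `fW`-value and the `ta` coins determine the pattern -/
  dead : ∀ g, Good g → ∀ k, r ≤ k → k < rmax P x.length → ∀ p p' : ZPat P x.length (nOf x.length),
    P.fW (zW P x.length (nOf x.length) x g k p') = P.fW (zW P x.length (nOf x.length) x g k p) →
      tacP P x.length (nOf x.length) p' = tacP P x.length (nOf x.length) p → p' = p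

/-! ### The final state of the branch with given coins -/

section FinalOfCoins

variable (S : SemHyp P) (x : List Bool)

/-- The final zone-wise state of the branch with coins `c`. [folklore] -/
abbrev fsOf (c : Coins P x.length (nOf x.length)) : St :=
  finSt P S x.length (nOf x.length) x (branchW P x.length (nOf x.length) x c)

variable {S x}

/-- **The image of the branch with coins `c` under the compiled program, wire by wire.** [folklore] -/
theorem kappa_branchOf_apply (c : Coins P x.length (nOf x.length)) (i : Fin (x.length + anc P x.length)) :
    kappa P x.length (branchOf P x c) i = toWires P x.length (nOf x.length) (fsOf S x c) i := by
  rw [kappa_apply_of_isBranch S (isBranch_branchOf c) i, liftW_branchOf]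

variable {Good : GPat P x.length → Prop} {r d₀ : ℕ}

/-- Liveness of register `k` on a branch with a good guess pattern is `k < r`. [folklore] -/
theorem act_iff_of_good (H : FibreHyp P S x Good r d₀) {c : Coins P x.length (nOf x.length)} (hc : Good c.1) {k : ℕ}
    (hk : k < rmax P x.length) :
    S.Act x.length x (guessOf P x.length (branchW P x.length (nOf x.length) x c)) k ↔ k < r :=
  (H.act_congr c.1 _ k fun _ ht => guessOf_branchW_eq_gExt c ht).trans (H.act_iff c.1 hc k hk)

/-- The word `W` receives on a branch is `zW` of the guess pattern and the zone pattern. [folklore] -/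
theorem wordW_eq_zW (c : Coins P x.length (nOf x.length)) (k : Fin (rmax P x.length)) :
    wordW P x.length x (guessOf P x.length (branchW P x.length (nOf x.length) x c)) (ixcOf P x.length (branchW P x.length (nOf x.length) x c) k)
      (tacOf P x.length (branchW P x.length (nOf x.length) x c) k) k = zW P x.length (nOf x.length) x c.1 k (c.2 k) := by
  have hA : (List.ofFn fun t : Fin (kap P x.length) => ixcOf P x.length (branchW P x.length (nOf x.length) x c) k t) =
      List.ofFn fun t : Fin (kap P x.length) => zoneFn P x.length (nOf x.length) (c.2 k) t := by
    congr 1; funext t; exact ixcOf_branchW c k t.isLt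
  have hB : (List.ofFn fun t : Fin (sig x.length) => tacOf P x.length (branchW P x.length (nOf x.length) x c) k t) =
      List.ofFn fun t : Fin (sig x.length) => tacP P x.length (nOf x.length) (c.2 k) t := by
    congr 1; funext t; exact tacOf_branchW c k t.isLt
  have hG : (List.ofFn fun t : Fin (gam P x.length) => guessOf P x.length (branchW P x.length (nOf x.length) x c) t) =
      List.ofFn fun t : Fin (gam P x.length) => gExt P x.length c.1 t := by
    congr 1; funext t; rw [guessOf_branchW_eq_gExt c t.isLt]
  unfold zW wordW
  rw [hA, hB, hG]

/-- The garbage zone of the final state, through the zone pattern. [folklore] -/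
theorem fsOf_gz (c : Coins P x.length (nOf x.length)) (k : Fin (rmax P x.length)) (t : ℕ) :
    (fsOf S x c).gz k t = readOut P.eW P.MW (n0W P x.length) (P.fW (zW P x.length (nOf x.length) x c.1 k (c.2 k))) (NNW P x.length + t) := by
  change readOut P.eW P.MW (n0W P x.length) (P.fW (wordW P x.length x _ _ _ k)) (NNW P x.length + t) = _
  rw [wordW_eq_zW c k]

/-- The mask-garbage zone of the final state, through the zone pattern. [folklore] -/
theorem fsOf_gt (H : FibreHyp P S x Good r d₀) {c : Coins P x.length (nOf x.length)} (hc : Good c.1) (k : Fin (rmax P x.length))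
    {t : ℕ} (ht : t < sig x.length) :
    (fsOf S x c).gt k t = (decide (r ≤ (k : ℕ)) && tacP P x.length (nOf x.length) (c.2 k) t) := by
  change (!decide (S.Act x.length x (guessOf P x.length (branchW P x.length (nOf x.length) x c)) k) &&
    tacOf P x.length (branchW P x.length (nOf x.length) x c) k t) = _
  rw [tacOf_branchW c k ht]
  by_cases hk : (k : ℕ) < r
  · rw [decide_eq_true ((act_iff_of_good H hc k.isLt).2 hk), decide_eq_false (by omega)]; rfl
  · rw [decide_eq_false (fun h => hk ((act_iff_of_good H hc k.isLt).1 h)), decide_eq_true (by omega)]; rfl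

/-- A slot of the final state, through the zone pattern. [folklore] -/
theorem fsOf_slot (H : FibreHyp P S x Good r d₀) {c : Coins P x.length (nOf x.length)} (hc : Good c.1) {k : ℕ} (hk : k < rmax P x.length)
    {t : ℕ} (ht : t < slotW (nOf x.length)) :
    (fsOf S x c).slot k t = (decide (k < r) && tacP P x.length (nOf x.length) (c.2 ⟨k, hk⟩) t) := by
  have hsw : slotW (nOf x.length) ≤ sig x.length := by unfold sig slotW; have := ell_mono (nOf_le x.length); omega
  change (decide (k < rmax P x.length ∧ t < slotW (nOf x.length) ∧ S.Act x.length x (guessOf P x.length (branchW P x.length (nOf x.length) x c)) k) &&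
    tacOf P x.length (branchW P x.length (nOf x.length) x c) k t) = _
  rw [show tacOf P x.length (branchW P x.length (nOf x.length) x c) k t = tacP P x.length (nOf x.length) (c.2 ⟨k, hk⟩) t from
    tacOf_branchW c ⟨k, hk⟩ (by omega)]
  by_cases hkr : k < r
  · rw [decide_eq_true ⟨hk, ht, (act_iff_of_good H hc hk).2 hkr⟩, decide_eq_true hkr]
  · rw [decide_eq_false (fun h => hkr ((act_iff_of_good H hc hk).1 h.2.2)), decide_eq_false hkr]

/-- The guess zone of the final state. [folklore] -/
theorem fsOf_g (c : Coins P x.length (nOf x.length)) {t : ℕ} (ht : t < gam P x.length) :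
    (fsOf S x c).g t = gExt P x.length c.1 t :=
  guessOf_branchW_eq_gExt c ht

/-- **The wires of the final state between the live slots and the data area are `0`.** [folklore] -/
theorem toWires_fsOf_eq_false (H : FibreHyp P S x Good r d₀) {c : Coins P x.length (nOf x.length)} (hc : Good c.1) {i : ℕ}
    (h1 : ell (nOf x.length) + r * slotW (nOf x.length) ≤ i) (h2 : i < A0 P x.length) :
    toWires P x.length (nOf x.length) (fsOf S x c) i = false := by
  have hn := nOf_le x.length
  have hsw : 0 < slotW (nOf x.length) := by unfold slotW; omega
  by_cases h3 : i < ell (nOf x.length) + rmax P x.length * slotW (nOf x.length)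
  · obtain ⟨heq, hlt⟩ := zone_eq_divMod (base := ell (nOf x.length)) (w := slotW (nOf x.length)) (i := i) hsw (by omega)
    have hk : (i - ell (nOf x.length)) / slotW (nOf x.length) < rmax P x.length := by
      by_contra hge
      have hm : rmax P x.length * slotW (nOf x.length) ≤ (i - ell (nOf x.length)) / slotW (nOf x.length) * slotW (nOf x.length) :=
        Nat.mul_le_mul_right _ (not_lt.1 hge)
      omega
    have hkr : ¬ (i - ell (nOf x.length)) / slotW (nOf x.length) < r := fun hlt' => by
      have hm : ((i - ell (nOf x.length)) / slotW (nOf x.length) + 1) * slotW (nOf x.length) ≤ r * slotW (nOf x.length) :=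
        Nat.mul_le_mul_right _ hlt'
      rw [Nat.add_mul, Nat.one_mul] at hm
      omega
    rw [toWires_slot (P := P) (fsOf S x c) hn hk hlt heq, fsOf_slot H hc hk hlt, decide_eq_false hkr]
    rfl
  · exact toWires_pad (fsOf S x c) hn (not_lt.1 h3) h2

end FinalOfCoins

/-! ### The solver's block and the off-block content -/

section Block

variable {S : SemHyp P} {x : List Bool} {Good : GPat P x.length → Prop} {r d₀ : ℕ}

/-- The width of the solver's block. [folklore] -/
abbrev mD (P : Params) (L : ℕ) : ℕ := ell (nOf L) + P.FD.ancillas (ell (nOf L))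

/-- The solver's block embedding is the initial-segment inclusion. [folklore] -/
theorem val_solverEmb (L : ℕ) (j : Fin (mD P L)) : ((solverEmb P L j : Fin (L + anc P L)) : ℕ) = j := rfl

/-- The block lies below `bS ≤ A0`. [folklore] -/
theorem mD_le_bS (L : ℕ) : mD P L ≤ bS P L := solver_fits (nOf_le L)

/-- The zero-block representative, wire by wire. [folklore] -/
theorem extend_zero_apply (L : ℕ) (z : QReg (L + anc P L)) (i : Fin (L + anc P L)) :
    Function.extend (solverEmb P L) (fun _ => false) z i = if (i : ℕ) < mD P L then false else z i := by
  split_ifs with h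
  · rw [show i = solverEmb P L ⟨i, h⟩ from Fin.ext rfl]
    exact extend_zero_apply_emb _ _ _
  · rw [Function.extend_apply' _ _ _ (fun ⟨j, hj⟩ => h (by rw [← hj]; exact j.isLt))]

/-- The image of a branch under the compiled program (the labels of `DCPMixture`). [folklore] -/
abbrev cEmb (P : Params) (x : List Bool) (c : Coins P x.length (nOf x.length)) : QReg (x.length + anc P x.length) :=
  kappa P x.length (branchOf P x c)

/-- **Same off-block data**: the same guess pattern, live zones with the same `fW`-value, dead zones
with the same pattern. [folklore] -/
def SameOff (P : Params) (x : List Bool) (r : ℕ) (c c' : Coins P x.length (nOf x.length)) : Prop :=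
  c'.1 = c.1 ∧ ∀ k : Fin (rmax P x.length),
    ((k : ℕ) < r → P.fW (zW P x.length (nOf x.length) x c.1 k (c'.2 k)) = P.fW (zW P x.length (nOf x.length) x c.1 k (c.2 k))) ∧
      (r ≤ (k : ℕ) → c'.2 k = c.2 k)

/-- Under `SameOff`, every zone has the same `fW`-value. [folklore] -/
theorem fW_eq_of_sameOff {c c' : Coins P x.length (nOf x.length)} (h : SameOff P x r c c') (k : Fin (rmax P x.length)) :
    P.fW (zW P x.length (nOf x.length) x c.1 k (c'.2 k)) = P.fW (zW P x.length (nOf x.length) x c.1 k (c.2 k)) := by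
  by_cases hk : (k : ℕ) < r
  · exact (h.2 k).1 hk
  · rw [(h.2 k).2 (not_lt.1 hk)]

/-- The wires of the guess zone. [folklore] -/
theorem oGz_add_lt (L : ℕ) (t : Fin (gam P L)) : oGz P L + t < L + anc P L := by
  have hc := offsets_chain (P := P) L; have := t.isLt; rw [add_anc]; omega

/-- The guess pattern shown by a label. [cite: Regev2004, Thm. 1.1 (proof, p. 7: the guesses)] -/
def gOf (P : Params) (L : ℕ) (y : QReg (L + anc P L)) : GPat P L := fun t => y ⟨oGz P L + t, oGz_add_lt L t⟩

/-- **The off-block event**: the guess zone shows a good pattern. [cite: Regev2004, Thm. 1.1 (proof, p. 7: the right guess)] -/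
def Toff (P : Params) (x : List Bool) (Good : GPat P x.length → Prop) (y : QReg (x.length + anc P x.length)) : Prop :=
  Good (gOf P x.length y)

/-- `Toff` is decidable. [folklore] -/
instance instDecidablePredToff (P : Params) (x : List Bool) (Good : GPat P x.length → Prop) [DecidablePred Good] :
    DecidablePred (Toff P x Good) := fun _ => by
  unfold Toff; infer_instance

/-- The guess pattern shown by the zero-block representative of the image of a branch is its guess
pattern. [folklore] -/
theorem gOf_extend_cEmb (S : SemHyp P) (c : Coins P x.length (nOf x.length)) :
    gOf P x.length (Function.extend (solverEmb P x.length) (fun _ => false) (cEmb P x c)) = c.1 := by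
  have hch := offsets_chain (P := P) x.length
  have hmD : ell (nOf x.length) + P.FD.ancillas (ell (nOf x.length)) ≤ bS P x.length := mD_le_bS x.length
  have hmDdef : mD P x.length = ell (nOf x.length) + P.FD.ancillas (ell (nOf x.length)) := rfl
  funext t
  have ht := t.isLt
  unfold gOf
  rw [extend_zero_apply, if_neg (by simp only; omega)]
  change kappa P x.length (branchOf P x c) _ = _
  rw [kappa_branchOf_apply (S := S), toWires_gz0 (fsOf S x c) (nOf_le x.length) (by simp only; omega) (by simp only; omega)]
  simp only [Nat.add_sub_cancel_left]
  rw [fsOf_g c ht, gExt, dif_pos ht]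

/-- **The off-block event on a branch is "the guess pattern is good".** [folklore] -/
theorem toff_iff (S : SemHyp P) (c : Coins P x.length (nOf x.length)) :
    Toff P x Good (Function.extend (solverEmb P x.length) (fun _ => false) (cEmb P x c)) ↔ Good c.1 := by
  unfold Toff; rw [gOf_extend_cEmb S c]

/-- Labels with the same off-block content come from branches with the same guess pattern. [folklore] -/
theorem fst_eq_of_extend_eq (S : SemHyp P) {c c' : Coins P x.length (nOf x.length)}
    (hoff : Function.extend (solverEmb P x.length) (fun _ => false) (cEmb P x c') =
      Function.extend (solverEmb P x.length) (fun _ => false) (cEmb P x c)) : c'.1 = c.1 := by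
  rw [← gOf_extend_cEmb S c', ← gOf_extend_cEmb S c, hoff]

/-! ### Off-block content and the zone data -/

/-- **From the same off-block content to the same zone data.** [folklore] -/
theorem sameOff_of_extend_eq (H : FibreHyp P S x Good r d₀) {c c' : Coins P x.length (nOf x.length)} (hc : Good c.1)
    (hoff : Function.extend (solverEmb P x.length) (fun _ => false) (cEmb P x c') =
      Function.extend (solverEmb P x.length) (fun _ => false) (cEmb P x c)) :
    SameOff P x r c c' := by
  have hch := offsets_chain (P := P) x.length
  have hmD : ell (nOf x.length) + P.FD.ancillas (ell (nOf x.length)) ≤ bS P x.length := mD_le_bS x.length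
  have hmDdef : mD P x.length = ell (nOf x.length) + P.FD.ancillas (ell (nOf x.length)) := rfl
  have hn := nOf_le x.length
  have h1 : c'.1 = c.1 := fst_eq_of_extend_eq S hoff
  have hc' : Good c'.1 := by rw [h1]; exact hc
  -- reading an off-block wire of the two final states
  have hread : ∀ i : ℕ, mD P x.length ≤ i → (hi : i < x.length + anc P x.length) →
      toWires P x.length (nOf x.length) (fsOf S x c') i = toWires P x.length (nOf x.length) (fsOf S x c) i := fun i h1 h2 => by
    have := congrFun hoff ⟨i, h2⟩
    rw [extend_zero_apply, extend_zero_apply, if_neg (by simp only; omega), if_neg (by simp only; omega)] at this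
    change kappa P x.length (branchOf P x c') _ = kappa P x.length (branchOf P x c) _ at this
    rwa [kappa_branchOf_apply (S := S), kappa_branchOf_apply (S := S)] at this
  refine ⟨h1, fun k => ?_⟩
  have hk := k.isLt
  -- the garbage zones agree, hence the `fW`-values
  have hG : P.fW (zW P x.length (nOf x.length) x c.1 k (c'.2 k)) = P.fW (zW P x.length (nOf x.length) x c.1 k (c.2 k)) := by
    have hro : readOut P.eW P.MW (n0W P x.length) (P.fW (zW P x.length (nOf x.length) x c.1 k (c'.2 k))) =
        readOut P.eW P.MW (n0W P x.length) (P.fW (zW P x.length (nOf x.length) x c.1 k (c.2 k))) := by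
      funext i
      by_cases hi : NNW P x.length ≤ i ∧ i < NNW P x.length + copyW P x.length
      · have hG' := oG_add_copyW_le (P := P) hk
        have e : i = NNW P x.length + (i - NNW P x.length) := by omega
        have hw := hread (gBase P x.length + k * copyW P x.length + (i - NNW P x.length)) (by unfold oG at hG'; omega)
          (by rw [add_anc]; unfold oG at hG'; omega)
        rw [toWires_gzone (fsOf S x c') hn hk (by omega) rfl, toWires_gzone (fsOf S x c) hn hk (by omega) rfl,
          fsOf_gz c' k, fsOf_gz c k, h1, ← e] at hw
        exact hw
      · have hi' : ¬ (NN P.eW P.MW (n0W P x.length) ≤ i ∧ i < NN P.eW P.MW (n0W P x.length) + copyN P.eW P.MW (n0W P x.length)) := hi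
        unfold readOut
        rw [if_neg hi', if_neg hi']
    have hl1 := length_wordW (P := P) (L := x.length) x (gExt P x.length c.1) (zoneFn P x.length (nOf x.length) (c'.2 k))
      (tacP P x.length (nOf x.length) (c'.2 k)) k
    have hl2 := length_wordW (P := P) (L := x.length) x (gExt P x.length c.1) (zoneFn P x.length (nOf x.length) (c.2 k))
      (tacP P x.length (nOf x.length) (c.2 k)) k
    have hM1 := P.hMW (zW P x.length (nOf x.length) x c.1 k (c'.2 k))
    have hM2 := P.hMW (zW P x.length (nOf x.length) x c.1 k (c.2 k))
    unfold zW at hl1 hl2 hM1 hM2 hro ⊢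
    rw [hl1] at hM1
    rw [hl2] at hM2
    exact eq_of_readOut_eq hl1 hl2 hM1 hM2 hro
  refine ⟨fun _ => hG, fun hkr => H.dead c.1 hc k hkr hk _ _ hG ?_⟩
  -- on a dead zone the mask-garbage zones agree, hence the `ta` coins
  funext t
  by_cases ht : t < sig x.length
  · have hGT := oGT_add_sig_le (P := P) hk
    have hw := hread (gtBase P x.length + k * sig x.length + t) (by unfold oGT at hGT; omega) (by rw [add_anc]; unfold oGT at hGT; omega)
    rw [toWires_gt (fsOf S x c') hn hk ht rfl, toWires_gt (fsOf S x c) hn hk ht rfl, fsOf_gt H hc' k ht, fsOf_gt H hc k ht,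
      decide_eq_true hkr] at hw
    simpa using hw
  · have hsw : slotW (nOf x.length) ≤ sig x.length := by unfold sig slotW; have := ell_mono hn; omega
    rw [tacP_eq_false_of_le _ (by omega), tacP_eq_false_of_le _ (by omega)]

/-- **From the same zone data to the same off-block content.** [folklore] -/
theorem extend_eq_of_sameOff (H : FibreHyp P S x Good r d₀) {c c' : Coins P x.length (nOf x.length)} (hc : Good c.1)
    (hS : SameOff P x r c c') :
    Function.extend (solverEmb P x.length) (fun _ => false) (cEmb P x c') =
      Function.extend (solverEmb P x.length) (fun _ => false) (cEmb P x c) := by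
  have hch := offsets_chain (P := P) x.length
  have hmD : ell (nOf x.length) + P.FD.ancillas (ell (nOf x.length)) ≤ bS P x.length := mD_le_bS x.length
  have hmDdef : mD P x.length = ell (nOf x.length) + P.FD.ancillas (ell (nOf x.length)) := rfl
  have hn := nOf_le x.length
  have hfits := H.fits
  have h1 : c'.1 = c.1 := hS.1
  have hc' : Good c'.1 := by rw [h1]; exact hc
  have hsw0 : 0 < slotW (nOf x.length) := by unfold slotW; omega
  have hsw : slotW (nOf x.length) ≤ sig x.length := by unfold sig slotW; have := ell_mono hn; omega
  funext i
  rw [extend_zero_apply, extend_zero_apply]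
  split_ifs with hi
  · rfl
  change kappa P x.length (branchOf P x c') i = kappa P x.length (branchOf P x c) i
  rw [kappa_branchOf_apply (S := S), kappa_branchOf_apply (S := S)]
  refine toWires_eq_of (fsOf S x c') (fsOf S x c) (hslot := fun hlo hhi => ?_) (hg := fun hlo hhi => ?_)
    (hgz := fun hlo hhi => ?_) (hgt := fun hlo hhi => ?_) (hrest := fun hlo => ?_)
  · -- a slot off the block is dead
    obtain ⟨heq, hlt⟩ := zone_eq_divMod (base := ell (nOf x.length)) (w := slotW (nOf x.length)) (i := (i : ℕ)) hsw0 hlo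
    have hk : (i - ell (nOf x.length)) / slotW (nOf x.length) < rmax P x.length := by
      by_contra hge
      have hm : rmax P x.length * slotW (nOf x.length) ≤ (i - ell (nOf x.length)) / slotW (nOf x.length) * slotW (nOf x.length) :=
        Nat.mul_le_mul_right _ (not_lt.1 hge)
      omega
    have hkr : ¬ (i - ell (nOf x.length)) / slotW (nOf x.length) < r := fun hlt' => by
      have hm : ((i - ell (nOf x.length)) / slotW (nOf x.length) + 1) * slotW (nOf x.length) ≤ r * slotW (nOf x.length) :=
        Nat.mul_le_mul_right _ hlt'
      rw [Nat.add_mul, Nat.one_mul] at hm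
      simp only [mD] at hi
      omega
    rw [fsOf_slot H hc' hk hlt, fsOf_slot H hc hk hlt, decide_eq_false hkr]
    rfl
  · rw [fsOf_g c' (by omega), fsOf_g c (by omega), h1]
  · have hcp := copyW_pos (P := P) x.length
    obtain ⟨heq, hlt⟩ := zone_eq_divMod (base := gBase P x.length) (w := copyW P x.length) (i := (i : ℕ)) hcp hlo
    have hk : (i - gBase P x.length) / copyW P x.length < rmax P x.length := by
      by_contra hge
      have hm : rmax P x.length * copyW P x.length ≤ (i - gBase P x.length) / copyW P x.length * copyW P x.length :=
        Nat.mul_le_mul_right _ (not_lt.1 hge)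
      omega
    rw [fsOf_gz c' ⟨_, hk⟩, fsOf_gz c ⟨_, hk⟩, h1, fW_eq_of_sameOff hS ⟨_, hk⟩]
  · have hsig : 0 < sig x.length := by unfold sig slotW; omega
    obtain ⟨heq, hlt⟩ := zone_eq_divMod (base := gtBase P x.length) (w := sig x.length) (i := (i : ℕ)) hsig hlo
    have hk : (i - gtBase P x.length) / sig x.length < rmax P x.length := by
      by_contra hge
      have hm : rmax P x.length * sig x.length ≤ (i - gtBase P x.length) / sig x.length * sig x.length :=
        Nat.mul_le_mul_right _ (not_lt.1 hge)
      omega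
    rw [fsOf_gt H hc' ⟨_, hk⟩ hlt, fsOf_gt H hc ⟨_, hk⟩ hlt]
    by_cases hkr : r ≤ (i - gtBase P x.length) / sig x.length
    · rw [(hS.2 ⟨_, hk⟩).2 hkr]
    · rw [decide_eq_false hkr]; rfl
  · change branchW P x.length (nOf x.length) x c' i = branchW P x.length (nOf x.length) x c i
    rw [branchW_of_gBase_le c' (by omega), branchW_of_gBase_le c (by omega)]

/-! ### The fibres are supports of DCP input states -/

/-- **The register contents of the branch with coins `c`** (for the solver: `r` registers). [cite: Regev2004, Lemma 3.12 (proof, p. 14)] -/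
def rhoOf (H : FibreHyp P S x Good r d₀) (c : Coins P x.length (nOf x.length)) : Fin r → Register (modN (nOf x.length)) :=
  fun k => H.regOf c.1 k (c.2 (Fin.castLE H.hr k))

/-- Reading a wire of a label. [folklore] -/
theorem qbit_fin {m : ℕ} (u : QReg m) (j : Fin m) : qbit u j = u j := by
  unfold qbit; rw [dif_pos j.isLt]

/-- Reading a block wire of the image of a branch. [folklore] -/
theorem qbit_cEmb_comp (c : Coins P x.length (nOf x.length)) {p : ℕ} (hp : p < mD P x.length) :
    qbit (cEmb P x c ∘ solverEmb P x.length) p = toWires P x.length (nOf x.length) (fsOf S x c) p := by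
  unfold qbit
  rw [dif_pos hp]
  exact kappa_branchOf_apply (S := S) c _

/-- `bitVal` only reads the digits below `ℓ`. [folklore] -/
theorem bitVal_congr {b b' : ℕ → Bool} {ℓ : ℕ} (h : ∀ t, t < ℓ → b t = b' t) : bitVal b ℓ = bitVal b' ℓ :=
  sum_congr rfl fun t ht => by rw [h t (mem_range.1 ht)]

/-- `regOf` is constant on the fibres. [folklore] -/
theorem rhoOf_eq_of_sameOff (H : FibreHyp P S x Good r d₀) {c c' : Coins P x.length (nOf x.length)} (hc : Good c.1)
    (hS : SameOff P x r c c') : rhoOf H c' = rhoOf H c := by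
  funext k
  have hkm : (k : ℕ) < rmax P x.length := lt_of_lt_of_le k.isLt H.hr
  unfold rhoOf
  rw [hS.1]
  exact (H.rel c.1 hc k (c.2 ⟨k, hkm⟩) (c'.2 ⟨k, hkm⟩) ((hS.2 ⟨k, hkm⟩).1 k.isLt)).2

/-- **The block content of a branch in the fibre of `c` lies in the support of the input state with
contents `rhoOf c`.** [cite: Regev2004, Lemma 3.12 (proof, p. 14)] -/
theorem dcpSet_of_sameOff (H : FibreHyp P S x Good r d₀) {c c' : Coins P x.length (nOf x.length)} (hc : Good c.1)
    (hS : SameOff P x r c c') :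
    DcpSet (mD P x.length) (modN (nOf x.length)) r d₀ (rhoOf H c) (cEmb P x c' ∘ solverEmb P x.length) := by
  have hch := offsets_chain (P := P) x.length
  have hmD : ell (nOf x.length) + P.FD.ancillas (ell (nOf x.length)) ≤ bS P x.length := mD_le_bS x.length
  have hmDdef : mD P x.length = ell (nOf x.length) + P.FD.ancillas (ell (nOf x.length)) := rfl
  have hn := nOf_le x.length
  have hfits := H.fits
  have hc' : Good c'.1 := by rw [hS.1]; exact hc
  have hsw0 : 0 < slotW (nOf x.length) := by unfold slotW; omega
  refine ⟨fun t => ?_, fun k => ?_, fun i hi => ?_⟩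
  · have ht : (t : ℕ) < ell (nOf x.length) := lt_of_lt_of_eq t.isLt (len_modN _)
    rw [qbit_cEmb_comp c' (by change (t : ℕ) < ell (nOf x.length) + _; omega), toWires_pre (fsOf S x c') ht, getD_encodeNat_modN]
    rfl
  · have hk : (k : ℕ) < r := k.isLt
    have hkm : (k : ℕ) < rmax P x.length := lt_of_lt_of_le hk H.hr
    have hin : ell (nOf x.length) + (k + 1) * slotW (nOf x.length) ≤ ell (nOf x.length) + P.FD.ancillas (ell (nOf x.length)) := by
      have : (k + 1) * slotW (nOf x.length) ≤ r * slotW (nOf x.length) := Nat.mul_le_mul_right _ hk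
      omega
    rw [len_modN, show ell (nOf x.length) + (k : ℕ) * (ell (nOf x.length) + 1) = oSlot (nOf x.length) k from rfl]
    have hsl : oSlot (nOf x.length) k + slotW (nOf x.length) ≤ ell (nOf x.length) + P.FD.ancillas (ell (nOf x.length)) := by
      unfold oSlot; rw [Nat.add_mul, Nat.one_mul] at hin; omega
    have hctrl : qbit (cEmb P x c' ∘ solverEmb P x.length) (oSlot (nOf x.length) k) = ctrl P x.length (nOf x.length) (c'.2 ⟨k, hkm⟩) := by
      rw [qbit_cEmb_comp c' (by omega), toWires_slot (fsOf S x c') hn hkm hsw0 (by unfold oSlot; omega), fsOf_slot H hc' hkm hsw0,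
        decide_eq_true hk]
      rfl
    have hval : readNat (cEmb P x c' ∘ solverEmb P x.length) (oSlot (nOf x.length) k + 1) (ell (nOf x.length)) =
        val P x.length (nOf x.length) (c'.2 ⟨k, hkm⟩) := by
      rw [readNat_eq_bitVal]
      refine bitVal_congr fun t ht => ?_
      have ht' : 1 + t < slotW (nOf x.length) := by unfold slotW; omega
      rw [qbit_cEmb_comp c' (by omega), toWires_slot (fsOf S x c') hn hkm ht' (by unfold oSlot; omega), fsOf_slot H hc' hkm ht',
        decide_eq_true hk]
      rfl
    rw [hctrl, hval]
    exact (H.rel c.1 hc k (c.2 ⟨k, hkm⟩) (c'.2 ⟨k, hkm⟩) ((hS.2 ⟨k, hkm⟩).1 hk)).1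
  · rw [len_modN] at hi
    have hi2 : (i : ℕ) < ell (nOf x.length) + P.FD.ancillas (ell (nOf x.length)) := i.isLt
    change kappa P x.length (branchOf P x c') (solverEmb P x.length i) = false
    rw [kappa_branchOf_apply (S := S), val_solverEmb]
    exact toWires_fsOf_eq_false H hc' hi (by omega)

/-- **Every element of the support is the block content of a branch in the fibre.** [cite: Regev2004, Lemma 3.12 (proof, p. 14)] -/
theorem exists_of_dcpSet (H : FibreHyp P S x Good r d₀) {c : Coins P x.length (nOf x.length)} (hc : Good c.1)
    {u : QReg (mD P x.length)} (hu : DcpSet (mD P x.length) (modN (nOf x.length)) r d₀ (rhoOf H c) u) :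
    ∃ c' : Coins P x.length (nOf x.length), SameOff P x r c c' ∧ cEmb P x c' ∘ solverEmb P x.length = u := by
  classical
  have hch := offsets_chain (P := P) x.length
  have hmD : ell (nOf x.length) + P.FD.ancillas (ell (nOf x.length)) ≤ bS P x.length := mD_le_bS x.length
  have hmDdef : mD P x.length = ell (nOf x.length) + P.FD.ancillas (ell (nOf x.length)) := rfl
  have hn := nOf_le x.length
  have hfits := H.fits
  have hsw0 : 0 < slotW (nOf x.length) := by unfold slotW; omega
  obtain ⟨hpre, hreg, htail⟩ := hu
  -- the new live patterns
  have hex : ∀ k : Fin (rmax P x.length), (k : ℕ) < r →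
      ∃ p', P.fW (zW P x.length (nOf x.length) x c.1 k p') = P.fW (zW P x.length (nOf x.length) x c.1 k (c.2 k)) ∧
        ctrl P x.length (nOf x.length) p' = qbit u (oSlot (nOf x.length) k) ∧
          val P x.length (nOf x.length) p' = readNat u (oSlot (nOf x.length) k + 1) (ell (nOf x.length)) := fun k hk => by
    have h := hreg ⟨k, hk⟩
    rw [len_modN] at h
    exact H.surj c.1 hc ⟨k, hk⟩ (c.2 k) _ _ h
  let c' : Coins P x.length (nOf x.length) := (c.1, fun k => if hk : (k : ℕ) < r then Classical.choose (hex k hk) else c.2 k)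
  have hc'2 : ∀ (k : Fin (rmax P x.length)) (hk : (k : ℕ) < r), c'.2 k = Classical.choose (hex k hk) := fun k hk => dif_pos hk
  have hS : SameOff P x r c c' := ⟨rfl, fun k =>
    ⟨fun hk => by rw [hc'2 k hk]; exact (Classical.choose_spec (hex k hk)).1, fun hk => dif_neg (by omega)⟩⟩
  refine ⟨c', hS, funext fun j => ?_⟩
  have hj2 : (j : ℕ) < ell (nOf x.length) + P.FD.ancillas (ell (nOf x.length)) := j.isLt
  change kappa P x.length (branchOf P x c') (solverEmb P x.length j) = u j
  rw [kappa_branchOf_apply (S := S), val_solverEmb]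
  by_cases h1 : (j : ℕ) < ell (nOf x.length)
  · rw [toWires_pre (fsOf S x c') h1]
    have := hpre ⟨j, by rw [len_modN]; exact h1⟩
    rw [getD_encodeNat_modN, qbit_fin] at this
    exact this.symm
  by_cases h2 : (j : ℕ) < ell (nOf x.length) + r * slotW (nOf x.length)
  · obtain ⟨heq, hlt⟩ := zone_eq_divMod (base := ell (nOf x.length)) (w := slotW (nOf x.length)) (i := (j : ℕ)) hsw0 (not_lt.1 h1)
    set k := (j - ell (nOf x.length)) / slotW (nOf x.length) with hkdef
    set t := (j - ell (nOf x.length)) % slotW (nOf x.length) with htdef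
    have hkr : k < r := by
      by_contra hge
      have hm : r * slotW (nOf x.length) ≤ k * slotW (nOf x.length) := Nat.mul_le_mul_right _ (not_lt.1 hge)
      omega
    have hkm : k < rmax P x.length := lt_of_lt_of_le hkr H.hr
    rw [toWires_slot (fsOf S x c') hn hkm hlt heq, fsOf_slot H (c := c') hc hkm hlt, decide_eq_true hkr, Bool.true_and, hc'2 ⟨k, hkm⟩ hkr]
    have hspec := Classical.choose_spec (hex ⟨k, hkm⟩ hkr)
    rcases Nat.eq_zero_or_pos t with ht0 | htpos
    · have e : (j : ℕ) = oSlot (nOf x.length) k := by unfold oSlot; omega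
      rw [ht0]
      change ctrl P x.length (nOf x.length) _ = u j
      rw [hspec.2.1, show oSlot (nOf x.length) k = ((j : Fin (mD P x.length)) : ℕ) from e.symm, qbit_fin]
    · have hb := bitVal_inj (b := fun s => tacP P x.length (nOf x.length) (Classical.choose (hex ⟨k, hkm⟩ hkr)) (1 + s))
        (b' := fun s => qbit u (oSlot (nOf x.length) k + 1 + s)) (ℓ := ell (nOf x.length)) hspec.2.2 (t := t - 1)
        (by unfold slotW at hlt; omega)
      dsimp only at hb
      rw [show 1 + (t - 1) = t by omega, show oSlot (nOf x.length) k + 1 + (t - 1) = ((j : Fin (mD P x.length)) : ℕ) by unfold oSlot; omega,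
        qbit_fin] at hb
      exact hb
  · rw [toWires_fsOf_eq_false H (c := c') hc (not_lt.1 h2) (by omega)]
    have := htail j (by rw [len_modN]; exact not_lt.1 h2)
    exact this.symm

end Block

/-! ### Product counting -/

section Counting

/-- Pairs with a property, counted fibrewise over the first component. [folklore] -/
theorem card_filter_prod_eq_sum {α β : Type*} [Fintype α] [Fintype β] (R : α → β → Prop) [∀ a, DecidablePred (R a)] :
    (univ.filter fun c : α × β => R c.1 c.2).card = ∑ a, (univ.filter (R a)).card := by
  classical
  simp only [card_eq_sum_ones, sum_filter]
  rw [Fintype.sum_prod_type]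

/-- Functions with a property at one argument. [folklore] -/
theorem card_filter_apply_eq {α : Type*} [Fintype α] {m : ℕ} (k : Fin m) (Q : α → Prop) [DecidablePred Q] :
    (univ.filter fun f : Fin m → α => Q (f k)).card = (univ.filter Q).card * Fintype.card α ^ (m - 1) := by
  classical
  obtain ⟨m', rfl⟩ : ∃ m', m = m' + 1 := ⟨m - 1, by have := k.pos; omega⟩
  rw [Nat.add_sub_cancel, ← Fintype.card_subtype, ← Fintype.card_subtype,
    show Fintype.card α ^ m' = Fintype.card (Fin m' → α) by rw [Fintype.card_fun, Fintype.card_fin], ← Fintype.card_prod]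
  exact Fintype.card_congr ((Equiv.subtypeEquiv (Fin.insertNthEquiv (fun _ => α) k).symm (fun f => Iff.rfl)).trans
    (Equiv.prodSubtypeFstEquivSubtypeProd (p := Q)))

end Counting

/-! ### The success bound of the routine -/

section Bound

variable {S : SemHyp P} {x : List Bool} {Good : GPat P x.length → Prop} {r d₀ : ℕ}

/-- **The good outputs**: the measured string shows a good guess pattern on the guess zone and the
hidden shift `d₀` on the solver's answer wires. [cite: Regev2004, Lemma 3.12 (proof, p. 14: the output of the two-point algorithm)] -/
def goodOutputs (P : Params) (L : ℕ) (Good : GPat P L → Prop) (d₀ : ℕ) : Set (List Bool) :=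
  {w | Good (fun t => w.getD (oGz P L + t) false) ∧ ∀ t, t < ell (nOf L) → w.getD t false = d₀.testBit t}

/-- Membership in the good outputs is decidable. [folklore] -/
instance instDecidablePredGoodOutputs (P : Params) (L : ℕ) (Good : GPat P L → Prop) [DecidablePred Good] (d₀ : ℕ) :
    DecidablePred (· ∈ goodOutputs P L Good d₀) :=
  fun w => decidable_of_iff (Good (fun t => w.getD (oGz P L + t) false) ∧ ∀ t, t < ell (nOf L) → w.getD t false = d₀.testBit t)
    Iff.rfl

/-- Reading a letter of `List.ofFn` (a twin of `HGadget.getD_ofFn`, not importable here). [folklore] -/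
theorem getD_ofFn_fin {m : ℕ} (z : QReg m) {i : ℕ} (hi : i < m) : (List.ofFn z).getD i false = z ⟨i, hi⟩ := by
  rw [List.getD_eq_getElem?_getD, List.getElem?_ofFn]
  simp [hi]

/-- **The good outputs as a product event**: the off-block content shows a good guess pattern, the
block content lies in the solver's success event. [folklore] -/
theorem mem_goodOutputs_iff (z : QReg (x.length + anc P x.length)) :
    List.ofFn z ∈ goodOutputs P x.length Good d₀ ↔
      Toff P x Good (Function.extend (solverEmb P x.length) (fun _ => false) z) ∧
        z ∘ solverEmb P x.length ∈ successEvent (mD P x.length) (modN (nOf x.length)) d₀ := by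
  have hch := offsets_chain (P := P) x.length
  have hmD : ell (nOf x.length) + P.FD.ancillas (ell (nOf x.length)) ≤ bS P x.length := mD_le_bS x.length
  have hmDdef : mD P x.length = ell (nOf x.length) + P.FD.ancillas (ell (nOf x.length)) := rfl
  have hW := add_anc (P := P) x.length
  change (Good (fun t => (List.ofFn z).getD (oGz P x.length + t) false) ∧
    ∀ t, t < ell (nOf x.length) → (List.ofFn z).getD t false = d₀.testBit t) ↔ _
  refine and_congr ?_ ?_
  · have e : (fun t : Fin (gam P x.length) => (List.ofFn z).getD (oGz P x.length + t) false) =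
        gOf P x.length (Function.extend (solverEmb P x.length) (fun _ => false) z) := by
      funext t
      have ht := t.isLt
      unfold gOf
      rw [getD_ofFn_fin z (by omega), extend_zero_apply, if_neg (by simp only; omega)]
    unfold Toff; rw [e]
  · change _ ↔ ∀ t, t < DCP.len (modN (nOf x.length)) → qbit (z ∘ solverEmb P x.length) t = d₀.testBit t
    rw [len_modN]
    refine forall_congr' fun t => imp_congr_right fun ht => ?_
    rw [getD_ofFn_fin z (by omega)]
    unfold qbit
    rw [dif_pos (show t < mD P x.length by omega)]
    exact Iff.rfl

/-- **The success bound of the routine.** Under the fibre hypotheses for the good guess patterns,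
the true register count `r` and the hidden shift `d₀`: if the solver's circuit at `ℓ = ell n`
succeeds with probability at least `q` on every admissible law of `r` register contents (as a DCP
solver does, `DCP.HasSolution`), and for every good guess pattern each live register is good for
all but a fraction `1/(log₂ N)^f` of the patterns of its zone, then the routine outputs a good guess
pattern on the guess zone and `d₀` on the answer wires with probability at least
`(#good patterns / 2^{|guess zone|}) · q`.
[cite: Regev2004, Lemma 3.12 (proof, pp. 14–15: "with probability 1/poly(n) the output is ((u_{i₀}−m)/p, u₂, …, uₙ)")] -/
theorem kernelProb_goodOutputs_ge [DecidablePred Good] (H : FibreHyp P S x Good r d₀) {f q : ℝ}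
    (hsol : ∀ μ : PMF (Fin r → Register (modN (nOf x.length))), IsAdmissible f (modN (nOf x.length)) μ →
      q ≤ successProb (P.FD.circ (ell (nOf x.length))) (modN (nOf x.length)) d₀ μ)
    (hfrac : ∀ g, Good g → ∀ k : Fin r, (1 - 1 / Real.logb 2 (modN (nOf x.length)) ^ f) * Fintype.card (ZPat P x.length (nOf x.length)) ≤
      ((univ.filter fun p : ZPat P x.length (nOf x.length) => (H.regOf g k p).1 = none).card : ℝ)) :
    ((univ.filter Good).card : ℝ) / 2 ^ gam P x.length * q ≤ (family P).kernelProb 0 x (goodOutputs P x.length Good d₀) := by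
  classical
  rw [kernelProb_family_eq]
  rw [show (∑ z : QReg (x.length + anc P x.length), if List.ofFn z ∈ goodOutputs P x.length Good d₀ then
      ‖(placeGate (solverEmb P x.length) ((P.FD.circ (ell (nOf x.length))).toMatrix 0) *ᵥ stateQ P x) z‖ ^ 2 else 0) =
      ∑ z : QReg (x.length + anc P x.length), if Toff P x Good (Function.extend (solverEmb P x.length) (fun _ => false) z) ∧
        z ∘ solverEmb P x.length ∈ successEvent (mD P x.length) (modN (nOf x.length)) d₀ then
      ‖(placeGate (solverEmb P x.length) ((P.FD.circ (ell (nOf x.length))).toMatrix 0) *ᵥ stateQ P x) z‖ ^ 2 else 0 from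
    sum_congr rfl fun z _ => if_congr (mem_goodOutputs_iff z) rfl rfl]
  -- the hypotheses of the mixture bound
  have hinj : Function.Injective (cEmb P x) := fun a b h => branchOf_injective x (kappa_injective P x.length h)
  have hΨ : ∀ y, stateQ P x y = if ∃ c, cEmb P x c = y then invSqrt2 ^ numCoins P x.length else 0 := stateQ_eq_coins
  have hm : DCP.len (modN (nOf x.length)) + r * (DCP.len (modN (nOf x.length)) + 1) ≤ mD P x.length := by
    rw [len_modN]; exact H.fits
  have hconst : ∀ c c', Toff P x Good (Function.extend (solverEmb P x.length) (fun _ => false) (cEmb P x c)) →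
      Function.extend (solverEmb P x.length) (fun _ => false) (cEmb P x c') = Function.extend (solverEmb P x.length) (fun _ => false) (cEmb P x c) →
        rhoOf H c' = rhoOf H c := fun c c' hT hoff =>
    rhoOf_eq_of_sameOff H ((toff_iff S c).1 hT) (sameOff_of_extend_eq H ((toff_iff S c).1 hT) hoff)
  have hmem : ∀ c c', Toff P x Good (Function.extend (solverEmb P x.length) (fun _ => false) (cEmb P x c)) →
      Function.extend (solverEmb P x.length) (fun _ => false) (cEmb P x c') = Function.extend (solverEmb P x.length) (fun _ => false) (cEmb P x c) →
        DcpSet (mD P x.length) (modN (nOf x.length)) r d₀ (rhoOf H c) (cEmb P x c' ∘ solverEmb P x.length) := fun c c' hT hoff =>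
    dcpSet_of_sameOff H ((toff_iff S c).1 hT) (sameOff_of_extend_eq H ((toff_iff S c).1 hT) hoff)
  have hsurj : ∀ c u, Toff P x Good (Function.extend (solverEmb P x.length) (fun _ => false) (cEmb P x c)) →
      DcpSet (mD P x.length) (modN (nOf x.length)) r d₀ (rhoOf H c) u →
        ∃ c', Function.extend (solverEmb P x.length) (fun _ => false) (cEmb P x c') =
          Function.extend (solverEmb P x.length) (fun _ => false) (cEmb P x c) ∧ cEmb P x c' ∘ solverEmb P x.length = u := fun c u hT hu => by
    obtain ⟨c', hS, hu'⟩ := exists_of_dcpSet H ((toff_iff S c).1 hT) hu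
    exact ⟨c', extend_eq_of_sameOff H ((toff_iff S c).1 hT) hS, hu'⟩
  -- the good set and its fractions, by fibrewise sums over the guess pattern
  have hr1 : rmax P x.length = (rmax P x.length - 1) + 1 := by unfold rmax; omega
  have hSset : (univ.filter fun c : Coins P x.length (nOf x.length) => Toff P x Good (Function.extend (solverEmb P x.length) (fun _ => false) (cEmb P x c))) =
      univ.filter fun c : Coins P x.length (nOf x.length) => Good c.1 := filter_congr fun c _ => toff_iff S c
  have hGsum : (univ.filter Good).card = ∑ a : GPat P x.length, if Good a then 1 else 0 := by
    rw [card_eq_sum_ones (univ.filter Good), sum_filter]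
  have hScard : (univ.filter fun c : Coins P x.length (nOf x.length) => Good c.1).card = (univ.filter Good).card * Fintype.card (ZPat P x.length (nOf x.length)) ^ rmax P x.length := by
    rw [card_filter_prod_eq_sum (fun (a : GPat P x.length) (_ : Fin (rmax P x.length) → ZPat P x.length (nOf x.length)) => Good a), hGsum, sum_mul]
    refine sum_congr rfl fun a _ => ?_
    rw [filter_const]
    split_ifs
    · rw [card_univ, Fintype.card_fun, Fintype.card_fin, one_mul]
    · rw [card_empty, zero_mul]
  have hgood : ∀ k : Fin r, (1 - 1 / Real.logb 2 (modN (nOf x.length)) ^ f) *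
      (univ.filter fun c : Coins P x.length (nOf x.length) => Toff P x Good (Function.extend (solverEmb P x.length) (fun _ => false) (cEmb P x c))).card ≤
      (((univ.filter fun c : Coins P x.length (nOf x.length) => Toff P x Good (Function.extend (solverEmb P x.length) (fun _ => false) (cEmb P x c))).filter
        fun c => (rhoOf H c k).1 = none).card : ℝ) := fun k => by
    rw [hSset, hScard, filter_filter, hGsum]
    simp only [rhoOf]
    rw [card_filter_prod_eq_sum (fun (a : GPat P x.length) (b : Fin (rmax P x.length) → ZPat P x.length (nOf x.length)) =>
      Good a ∧ (H.regOf a k (b (Fin.castLE H.hr k))).1 = none)]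
    push_cast
    rw [sum_mul, mul_sum]
    refine sum_le_sum fun a _ => ?_
    by_cases ha : Good a
    · rw [if_pos ha, filter_congr (q := fun b : Fin (rmax P x.length) → ZPat P x.length (nOf x.length) => (H.regOf a k (b (Fin.castLE H.hr k))).1 = none)
        (fun b _ => by simp only [ha, true_and]),
        card_filter_apply_eq (Fin.castLE H.hr k) (fun p => (H.regOf a k p).1 = none)]
      have hZ0 : (0 : ℝ) ≤ (Fintype.card (ZPat P x.length (nOf x.length)) : ℝ) ^ (rmax P x.length - 1) := by positivity
      calc (1 - 1 / Real.logb 2 (modN (nOf x.length)) ^ f) * ((1 : ℝ) * (Fintype.card (ZPat P x.length (nOf x.length)) : ℝ) ^ rmax P x.length)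
          = (1 - 1 / Real.logb 2 (modN (nOf x.length)) ^ f) * Fintype.card (ZPat P x.length (nOf x.length)) *
            (Fintype.card (ZPat P x.length (nOf x.length)) : ℝ) ^ (rmax P x.length - 1) := by
            conv_lhs => rw [hr1]
            ring
        _ ≤ ((univ.filter fun p : ZPat P x.length (nOf x.length) => (H.regOf a k p).1 = none).card : ℝ) *
            (Fintype.card (ZPat P x.length (nOf x.length)) : ℝ) ^ (rmax P x.length - 1) :=
            mul_le_mul_of_nonneg_right (hfrac a ha k) hZ0
        _ = (((univ.filter fun p : ZPat P x.length (nOf x.length) => (H.regOf a k p).1 = none).card *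
            Fintype.card (ZPat P x.length (nOf x.length)) ^ (rmax P x.length - 1) : ℕ) : ℝ) := by
            push_cast; ring
    · rw [if_neg ha, zero_mul, mul_zero]
      exact Nat.cast_nonneg _
  have hb := DCPMixture.bornSum_ge (solverEmb P x.length) (P.FD.circ (ell (nOf x.length))) (stateQ P x) (invSqrt2 ^ numCoins P x.length)
    (cEmb P x) (Toff P x Good) d₀ (rhoOf H) hinj hΨ hm hconst hmem hsurj hsol hgood
  refine le_trans (le_of_eq ?_) hb
  rw [norm_invSqrt2_pow_sq, hSset, hScard, Nat.cast_mul, Nat.cast_pow]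
  have hczN := card_zoneTuples (P := P) x.length
  rw [Fintype.card_fun, Fintype.card_fin] at hczN
  have hcz : ((Fintype.card (ZPat P x.length (nOf x.length)) : ℝ) ^ rmax P x.length) * 2 ^ gam P x.length = 2 ^ numCoins P x.length := by
    exact_mod_cast hczN
  have h2 : ((1 : ℝ) / 2) ^ numCoins P x.length * 2 ^ numCoins P x.length = 1 := by rw [← mul_pow]; norm_num
  have hg0 : (2 : ℝ) ^ gam P x.length ≠ 0 := pow_ne_zero _ two_ne_zero
  rw [div_mul_eq_mul_div, div_eq_iff hg0]
  calc ((univ.filter Good).card : ℝ) * q = (univ.filter Good).card * q * ((1 / 2) ^ numCoins P x.length * 2 ^ numCoins P x.length) := by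
        rw [h2, mul_one]
    _ = (univ.filter Good).card * q * ((1 / 2) ^ numCoins P x.length *
          (((Fintype.card (ZPat P x.length (nOf x.length)) : ℝ) ^ rmax P x.length) * 2 ^ gam P x.length)) := by rw [hcz]
    _ = (1 / 2) ^ numCoins P x.length * ((univ.filter Good).card * (Fintype.card (ZPat P x.length (nOf x.length)) : ℝ) ^ rmax P x.length) *
          q * 2 ^ gam P x.length := by ring

end Bound

end RegevRoutine

end Literature.Algebra.EuclideanLattices

end
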